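import Literature.NumberTheory.Automorphic.OrbitalIntegralFixedPointCount   -- ★ the λ = 0 model (`S = K`): `mem_preimage_mul_out_iff`, `pairwiseDisjoint_preimage_mul_out`, + ★ `OrbitalIntegralDoubleCosetUnfolding`, ★ `InvariantQuotientCompactSubgroup`
import Mathlib.Data.Real.ENatENNReal
import HarnessLib

/-!
# R90 · S6 «Ch. 14.1–14.5 stable trace formula» — WAVE 8 card W8-j (J1, generic layer): THE ORBITAL INTEGRAL OF THE INDICATOR OF A
# `K`-CONJUGATION-INVARIANT OPEN SET AT A COMPACT CENTRALISER IS `ν(K)` TIMES THE NUMBER OF COSETS `yK` WITH `y⁻¹ γ y ∈ S`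
# (`Theorems/R90S6OrbitalIndicatorShellCount.lean`)

DAG r5 row E1.3.5.2.1 «UNFOLDING at displacement m» (dealer R90-C14-plan (g2) card W8-j «elliptic reading», 2026-09-04T23:56:00Z; census verdict
23:59Z): the ★ λ = 0 file `OrbitalIntegralFixedPointCount` [Rogawski1990 §4.9 p. 54; Laumon1996 Lemma (5.3.2)] proves
`O_γ^{ν∕t}(1_K) = ν(K) · #{q ∈ G ⧸ K : γ • q = q}` for an element `γ` with COMPACT centraliser `C = C_G(γ)` (Haar measure `t` of total mass one),
`K ≤ G` open, `ν` a Haar measure on `G`.  HERE the same road for the indicator of ANY open set `S ⊆ G` invariant under conjugation by `K`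
(`k S k⁻¹ = S`, e.g. a `K`-double coset `K g₀ K` — the Hecke basis element `φ_λ = 1_{K₀ t_λ K₀}`):

  **`O_γ^{ν∕t}(1_S) = ν(K) · #{q ∈ G ⧸ K : q.out⁻¹ γ q.out ∈ S}`**

— the number of cosets `yK` whose «relative position to `γ·yK`» lies in the shell `S` (well defined by the `K`-conjugation invariance,
`inv_mul_mul_mem_iff_out`); `S = K` recovers the fixed-point count (`q.out⁻¹ γ q.out ∈ K ↔ γ • q = q`).  ROAD (verbatim the ★ file's): the set
`{g : g γ g⁻¹ ∈ S}` is the disjoint union over these `q` of the right cosets `K · q.out⁻¹` (fibres of `g ↦ g⁻¹K`), each of measure `ν(K)` (§1, in `[0, ∞]`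
with `Set.encard`, no finiteness); the quotient measure by the compact `C` is `t(C)⁻¹ · π_*ν` (★ `lintegral_quotientMeasure_eq_inv_mul`) and the orbital
integrand of `1_S` lifts to `1_{{g γ g⁻¹ ∈ S}}` (§2); the real orbital integral ★ `orbitalIntegral` follows for finitely many such `q` (§3).
The U(3) READING of the count (`q.out⁻¹ γ q.out ∈ K₀ tᵐ K₀ ⟺` the hyperspecial vertex `q.out·𝒪³` is displaced by `γ` by exactly `2m` in the
Bruhat–Tits tree) is the companion file (J2) `Theorems/R90S6EllipticOrbitalDisplacement.lean`.

Cell `hodgecm-mathlib`, crux H413 (`stmt-HodgeConjecture-24833`), route of record `HCCMUnconditional`; programme R90-TF (brief `director/R90-BRIEF.v2.md`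
1f40d54518340a35), section S6 (base `R90-C14`), seat R90-C14-p03 (g2).  Lane `--kind proof --supports stmt-HodgeConjecture-24833 --as helper`; THEOREMS ONLY
over ★ Literature carriers (no definition, no instance, no notation, no named fact, no kit, no `sorry`); generic topological-group layer.
HONEST LABEL: measure bookkeeping, count-neutral until the E1.3.5.2 ∕ E1.3.9 assemblies consume it; proves no printed global statement, discharges no
citation; HC_CM is proved only modulo the 7 printed citations (2 remaining named inputs: hLiu418 = stmt-HodgeConjecture-24832, h413 = stmt-HodgeConjecture-24833)
until rung 0 closes.

## References
* [Rogawski1990] J. D. Rogawski, *Automorphic Representations of Unitary Groups in Three Variables*, Ann. of Math. Stud. 123 (1990): §4.9 p. 54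
  («`Φ(γ, f) = Σ_{x ∈ G_γ\G/K} vol(G_γ ∩ xKx⁻¹)⁻¹ f(x⁻¹γx)`»), p. 55 (`Φ^κ(γ, φ)` for the Hecke basis).
* [Laumon1995] G. Laumon, *Cohomology of Drinfeld Modular Varieties*, Part I (1996): Lemma (5.3.2) p. 136.
* [Kottwitz1986BaseChangeUnits] R. E. Kottwitz, *Base change for unit elements of Hecke algebras*, Compositio Math. 60 (1986): §3.
-/

set_option autoImplicit false
-- the mandated namespace repeats the single-problem summit's segment (`HodgeConjecture.HodgeConjecture`)
set_option linter.dupNamespace false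

noncomputable section

open MeasureTheory Measure Topology Set Filter Function
open Literature.MeasureTheory.Group Literature.NumberTheory.Automorphic
open scoped ENNReal NNReal Pointwise

namespace Summit.HodgeConjecture.HodgeConjecture.R90.S6

/-! ## §1 `ν{g : g γ g⁻¹ ∈ S} = ν(K) · #{q ∈ G ⧸ K : q.out⁻¹ γ q.out ∈ S}` -/

section Shell

variable {G : Type*} [Group G] (γ : G) (K : Subgroup G) {S : Set G}
  (hSK : ∀ k : G, k ∈ K → ∀ g : G, k * g * k⁻¹ ∈ S ↔ g ∈ S)
include hSK

/-- **The shell condition is well defined on `G ⧸ K`**: for `S` invariant under `K`-conjugation, `g⁻¹ γ g ∈ S ↔ q.out⁻¹ γ q.out ∈ S` for the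
chosen representative `q.out = g k` (`k ∈ K`) of `q = gK`. [cite: Rogawski1990, §4.9 p. 54] -/
theorem inv_mul_mul_mem_iff_out (g : G) :
    g⁻¹ * γ * g ∈ S ↔ ((g : G ⧸ K)).out⁻¹ * γ * ((g : G ⧸ K)).out ∈ S := by
  obtain ⟨k, hk⟩ := QuotientGroup.mk_out_eq_mul K g
  rw [hk, mul_inv_rev, show (k : G)⁻¹ * g⁻¹ * γ * (g * k) = (k : G)⁻¹ * (g⁻¹ * γ * g) * (k : G)⁻¹⁻¹ by group]
  exact (hSK _ (K.inv_mem k.2) _).symm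

/-- **`{g : g γ g⁻¹ ∈ S}` is the disjoint union, over the cosets `q = yK` with `y⁻¹ γ y ∈ S`, of the right cosets `K · q.out⁻¹`** (the fibres of
`g ↦ g⁻¹K`, ★ `mem_preimage_mul_out_iff`; `S = K`: ★ `setOf_conj_mem_eq_biUnion_fixedPoints`). [cite: Laumon1995, Lemma (5.3.2) p. 136]
[cite: Rogawski1990, §4.9 p. 54] -/
theorem setOf_conj_mem_eq_biUnion_shell :
    {g : G | g * γ * g⁻¹ ∈ S} = ⋃ q ∈ {q : G ⧸ K | q.out⁻¹ * γ * q.out ∈ S}, (fun h : G => h * q.out) ⁻¹' (K : Set G) := by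
  ext g
  simp only [Set.mem_setOf_eq, Set.mem_iUnion, exists_prop]
  constructor
  · intro hg
    refine ⟨((g⁻¹ : G) : G ⧸ K), ?_, (mem_preimage_mul_out_iff K _ g).2 rfl⟩
    rw [← inv_mul_mul_mem_iff_out γ K hSK g⁻¹, inv_inv]
    exact hg
  · rintro ⟨q, hq, hgq⟩
    rw [mem_preimage_mul_out_iff K q g] at hgq
    rw [← hgq, ← inv_mul_mul_mem_iff_out γ K hSK g⁻¹, inv_inv] at hq
    exact hq

variable [TopologicalSpace G] [IsTopologicalGroup G] [MeasurableSpace G] [BorelSpace G]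
  (ν : Measure G) [ν.IsMulRightInvariant]

/-- **`ν{g : g γ g⁻¹ ∈ S} = ν(K) · #{q ∈ G ⧸ K : q.out⁻¹ γ q.out ∈ S}`** for an OPEN subgroup `K` of non-zero measure, a right-invariant `ν` and a
`K`-conjugation-invariant `S` — in `[0, ∞]` with `Set.encard` (both sides `∞` together): each fibre `K · q.out⁻¹` has measure `ν(K)`, the fibres are
disjoint and exhaust the set.  (`S = K`: ★ `measure_setOf_conj_mem_eq_mul_encard_fixedPoints`.) [cite: Laumon1995, Lemma (5.3.2) p. 136]
[cite: Rogawski1990, §4.9 p. 54] -/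
theorem measure_setOf_conj_mem_eq_mul_encard_shell (hK : IsOpen (K : Set G)) (hK0 : ν K ≠ 0) :
    ν {g : G | g * γ * g⁻¹ ∈ S} = ν K * (({q : G ⧸ K | q.out⁻¹ * γ * q.out ∈ S}.encard : ℕ∞) : ℝ≥0∞) := by
  have hA : ∀ q : G ⧸ K, ν ((fun h : G => h * q.out) ⁻¹' (K : Set G)) = ν K := fun q =>
    measure_preimage_mul_right ν q.out _
  have hAm : ∀ q : G ⧸ K, MeasurableSet ((fun h : G => h * q.out) ⁻¹' (K : Set G)) := fun q =>
    (hK.preimage (continuous_mul_const _)).measurableSet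
  have hsum : ∀ s : Finset (G ⧸ K),
      ν (⋃ q ∈ s, (fun h : G => h * q.out) ⁻¹' (K : Set G)) = (s.card : ℝ≥0∞) * ν K := by
    intro s
    rw [measure_biUnion_finset (pairwiseDisjoint_preimage_mul_out K (s : Set (G ⧸ K))) fun q _ => hAm q,
      Finset.sum_congr rfl fun q _ => hA q, Finset.sum_const, nsmul_eq_mul]
  rw [setOf_conj_mem_eq_biUnion_shell γ K hSK]
  rcases ({q : G ⧸ K | q.out⁻¹ * γ * q.out ∈ S}).finite_or_infinite with hfin | hinf
  · have hU : (⋃ q ∈ {q : G ⧸ K | q.out⁻¹ * γ * q.out ∈ S}, (fun h : G => h * q.out) ⁻¹' (K : Set G)) =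
        ⋃ q ∈ hfin.toFinset, (fun h : G => h * q.out) ⁻¹' (K : Set G) := by
      rw [← Finset.set_biUnion_coe, hfin.coe_toFinset]
    rw [hU, hsum, hfin.encard_eq_coe_toFinset_card, ENat.toENNReal_coe, mul_comm]
  · rw [hinf.encard_eq, ENat.toENNReal_top, ENNReal.mul_top hK0]
    have hle : ∀ n : ℕ, (n : ℝ≥0∞) * ν K ≤
        ν (⋃ q ∈ {q : G ⧸ K | q.out⁻¹ * γ * q.out ∈ S}, (fun h : G => h * q.out) ⁻¹' (K : Set G)) := by
      intro n
      obtain ⟨s, hs, hcard⟩ := hinf.exists_subset_card_eq n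
      rw [← hcard, ← hsum s, ← Finset.set_biUnion_coe]
      exact measure_mono (Set.biUnion_subset_biUnion_left hs)
    by_contra htop
    obtain ⟨n, hn⟩ := ENNReal.exists_nat_mul_gt hK0 htop
    exact absurd (hle n) (not_le.2 hn)

end Shell

/-! ## §2 The `[0, ∞]`-valued orbital integral of `1_S` at a COMPACT centraliser -/

section Quotient

variable {G : Type*} [Group G] [TopologicalSpace G] [IsTopologicalGroup G] [LocallyCompactSpace G]
  [SecondCountableTopology G] [T2Space G] [MeasurableSpace G] [BorelSpace G]
  (γ : G) (K : Subgroup G)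
  [MeasurableSpace (G ⧸ Subgroup.centralizer ({γ} : Set G))]
  [BorelSpace (G ⧸ Subgroup.centralizer ({γ} : Set G))]
  [hC : IsClosed ((Subgroup.centralizer ({γ} : Set G) : Subgroup G) : Set G)]
  (t : Measure (Subgroup.centralizer ({γ} : Set G))) [t.IsMulLeftInvariant]
  [IsFiniteMeasureOnCompacts t] [t.IsOpenPosMeasure] [t.IsInvInvariant] [SFinite t]
  (ν : Measure G) [IsHaarMeasure ν] [ν.IsMulRightInvariant]
  [CompactSpace (Subgroup.centralizer ({γ} : Set G))]
  {S : Set G} (hS : IsOpen S) (hSK : ∀ k : G, k ∈ K → ∀ g : G, k * g * k⁻¹ ∈ S ↔ g ∈ S)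

include hS in
/-- **`∫⁻_{G ⧸ C} 1_S(y γ y⁻¹) d(ν∕t) = t(C)⁻¹ · ν{g : g γ g⁻¹ ∈ S}`** for a COMPACT centraliser `C = C_G(γ)` and `S` open: the quotient measure by a compact
subgroup is `t(C)⁻¹ · π_* ν` (★ `lintegral_quotientMeasure_eq_inv_mul`) and the orbital integrand of `1_S` lifts to `1_{{g γ g⁻¹ ∈ S}}`.
[cite: Rogawski1990, §4.9 p. 54] -/
theorem lintegral_descConj_indicator_quotientMeasure_eq_inv_mul_measure_shell :
    ∫⁻ y, descConj γ (Subgroup.centralizer ({γ} : Set G))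
        (fun _ hg => Subgroup.mem_centralizer_singleton_iff.1 hg)
          (S.indicator (1 : G → ℝ≥0∞)) y
          ∂quotientMeasure (Subgroup.centralizer ({γ} : Set G)) t hC ν =
      (t Set.univ)⁻¹ * ν {g : G | g * γ * g⁻¹ ∈ S} := by
  have hSm : MeasurableSet {g : G | g * γ * g⁻¹ ∈ S} :=
    (hS.preimage ((continuous_id.mul continuous_const).mul continuous_id.inv)).measurableSet
  rw [lintegral_quotientMeasure_eq_inv_mul (Subgroup.centralizer ({γ} : Set G)) t ν
      (measurable_descConj γ _ _ (measurable_one.indicator hS.measurableSet)),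
    ← lintegral_indicator_one hSm]
  -- the lifted integrand `g ↦ 1_S(g γ g⁻¹)` IS `1_{{g | g γ g⁻¹ ∈ S}}` (definitionally)
  rfl

include hS hSK in
/-- **`∫⁻_{G ⧸ C} 1_S(y γ y⁻¹) d(ν∕t) = t(C)⁻¹ · ν(K) · #{q ∈ G ⧸ K : q.out⁻¹ γ q.out ∈ S}`** (compact centraliser, `K` open, `S` open and
`K`-conjugation-invariant; `[0, ∞]`-valued, no finiteness hypothesis). [cite: Rogawski1990, §4.9 p. 54] [cite: Laumon1995, Lemma (5.3.2) p. 136] -/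
theorem lintegral_descConj_indicator_quotientMeasure_eq_inv_mul_mul_encard_shell (hK : IsOpen (K : Set G)) :
    ∫⁻ y, descConj γ (Subgroup.centralizer ({γ} : Set G))
        (fun _ hg => Subgroup.mem_centralizer_singleton_iff.1 hg)
          (S.indicator (1 : G → ℝ≥0∞)) y
          ∂quotientMeasure (Subgroup.centralizer ({γ} : Set G)) t hC ν =
      (t Set.univ)⁻¹ * (ν K * (({q : G ⧸ K | q.out⁻¹ * γ * q.out ∈ S}.encard : ℕ∞) : ℝ≥0∞)) := by
  rw [lintegral_descConj_indicator_quotientMeasure_eq_inv_mul_measure_shell γ t ν hS,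
    measure_setOf_conj_mem_eq_mul_encard_shell γ K hSK ν hK (hK.measure_ne_zero ν ⟨1, K.one_mem⟩)]

include hS hSK in
/-- **THE SHELL COUNT, `[0, ∞]` form: `∫⁻_{G ⧸ C} 1_S(y γ y⁻¹) d(ν∕t) = ν(K) · #{q ∈ G ⧸ K : q.out⁻¹ γ q.out ∈ S}`** at the canonical normalisation
`t(C) = 1` of the compact centraliser (`Set.encard`, no finiteness hypothesis).  Print: «`Φ(γ, f) = Σ_{x ∈ G_γ\G∕K} vol(G_γ ∩ xKx⁻¹)⁻¹ f(x⁻¹ γ x)`» (p. 54)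
at `f = 1_S`: for compact `G_γ` of mass one each weight is the size of the `G_γ`-orbit of the coset `x⁻¹K`, and the double cosets enumerate the orbits.
[cite: Rogawski1990, §4.9 p. 54] [cite: Laumon1995, Lemma (5.3.2) p. 136] -/
theorem lintegral_descConj_indicator_quotientMeasure_eq_mul_encard_shell (hK : IsOpen (K : Set G)) (ht : t Set.univ = 1) :
    ∫⁻ y, descConj γ (Subgroup.centralizer ({γ} : Set G))
        (fun _ hg => Subgroup.mem_centralizer_singleton_iff.1 hg)
          (S.indicator (1 : G → ℝ≥0∞)) y
          ∂quotientMeasure (Subgroup.centralizer ({γ} : Set G)) t hC ν =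
      ν K * (({q : G ⧸ K | q.out⁻¹ * γ * q.out ∈ S}.encard : ℕ∞) : ℝ≥0∞) := by
  rw [lintegral_descConj_indicator_quotientMeasure_eq_inv_mul_mul_encard_shell γ K t ν hS hSK hK, ht, inv_one, one_mul]

/-! ## §3 The real orbital integral `O_γ^{ν∕t}(1_S)` as `ν(K)` times a natural number -/

include hS in
omit [IsFiniteMeasureOnCompacts t] [t.IsOpenPosMeasure] [t.IsInvInvariant] [SFinite t] [t.IsMulLeftInvariant]
  [LocallyCompactSpace G] [SecondCountableTopology G] [T2Space G] hC [IsHaarMeasure ν] [ν.IsMulRightInvariant]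
  [CompactSpace (Subgroup.centralizer ({γ} : Set G))] in
/-- The real orbital integral of `1_S` is the real part of the `[0, ∞]`-valued one: `O_γ^m(1_S) = (∫⁻ 1_S(x γ x⁻¹) dm).toReal` (non-negative indicator
integrand; `S = K`: ★ `orbitalIntegral_indicator_eq_toReal_lintegral`). [cite: Rogawski1990, §4.9 p. 54] -/
theorem orbitalIntegral_indicator_eq_toReal_lintegral_shell (m : Measure (G ⧸ Subgroup.centralizer ({γ} : Set G))) :
    orbitalIntegral γ (S.indicator (1 : G → ℝ)) m =
      (∫⁻ x, descConj γ (Subgroup.centralizer ({γ} : Set G))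
        (fun _ hg => Subgroup.mem_centralizer_singleton_iff.1 hg)
          (S.indicator (1 : G → ℝ≥0∞)) x ∂m).toReal := by
  rw [orbitalIntegral_eq_integral_descConj, integral_eq_lintegral_of_nonneg_ae]
  · congr 1
    refine lintegral_congr fun x => ?_
    induction x using QuotientGroup.induction_on with
    | H g =>
      rw [descConj_mk, descConj_mk]
      by_cases hg : g * γ * g⁻¹ ∈ S
      · rw [Set.indicator_of_mem hg, Set.indicator_of_mem hg, Pi.one_apply, Pi.one_apply, ENNReal.ofReal_one]
      · rw [Set.indicator_of_notMem hg, Set.indicator_of_notMem hg, ENNReal.ofReal_zero]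
  · refine Eventually.of_forall fun x => ?_
    induction x using QuotientGroup.induction_on with
    | H g =>
      rw [Pi.zero_apply, descConj_mk]
      exact Set.indicator_nonneg (fun _ _ => zero_le_one) _
  · exact (measurable_descConj γ _ _ (measurable_one.indicator hS.measurableSet)).aestronglyMeasurable

include hS hSK in
/-- **`O_γ^{ν∕t}(1_S) = ν(K) · #{q ∈ G ⧸ K : q.out⁻¹ γ q.out ∈ S}`** (real orbital integral ★ `orbitalIntegral`; compact centraliser of `t`-mass one, `K` open,
`S` open and `K`-conjugation-invariant, finitely many such cosets — e.g. at a closed class for `S` relatively compact).  For `S = K₀ tᵐ K₀` in `U(3)_w` this is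
Rogawski's `Φ(γ, φ_m)` as `ν(K₀)` times the number of hyperspecial vertices displaced by exactly `2m` (companion (J2) `R90S6EllipticOrbitalDisplacement`).
[cite: Rogawski1990, §4.9 pp. 54–55] [cite: Laumon1995, Lemma (5.3.2) p. 136] -/
theorem orbitalIntegral_indicator_quotientMeasure_eq_mul_ncard_shell (hK : IsOpen (K : Set G)) (ht : t Set.univ = 1)
    (hfin : {q : G ⧸ K | q.out⁻¹ * γ * q.out ∈ S}.Finite) :
    orbitalIntegral γ (S.indicator (1 : G → ℝ)) (quotientMeasure (Subgroup.centralizer ({γ} : Set G)) t hC ν) =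
      (ν K).toReal * ({q : G ⧸ K | q.out⁻¹ * γ * q.out ∈ S}.ncard : ℝ) := by
  rw [orbitalIntegral_indicator_eq_toReal_lintegral_shell γ hS,
    lintegral_descConj_indicator_quotientMeasure_eq_mul_encard_shell γ K t ν hS hSK hK ht, ENNReal.toReal_mul,
    hfin.encard_eq_coe_toFinset_card, ENat.toENNReal_coe, ENNReal.toReal_natCast, Set.ncard_eq_toFinset_card _ hfin]

include hS hSK in
/-- **`O_γ^{ν∕t}(1_S) = #{q ∈ G ⧸ K : q.out⁻¹ γ q.out ∈ S}`** at the unit normalisations `ν(K) = 1`, `t(C) = 1` — «the number of cosets `yK` with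
`y⁻¹ γ y ∈ S`» (for `S = K₀ tᵐ K₀`: the hyperspecial vertices displaced by `γ` by exactly `2m`). [cite: Rogawski1990, §4.9 pp. 54–55] -/
theorem orbitalIntegral_indicator_quotientMeasure_eq_natCard_shell (hK : IsOpen (K : Set G)) (ht : t Set.univ = 1) (hν : ν K = 1)
    (hfin : {q : G ⧸ K | q.out⁻¹ * γ * q.out ∈ S}.Finite) :
    orbitalIntegral γ (S.indicator (1 : G → ℝ)) (quotientMeasure (Subgroup.centralizer ({γ} : Set G)) t hC ν) =
      (Nat.card {q : G ⧸ K | q.out⁻¹ * γ * q.out ∈ S} : ℝ) := by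
  rw [orbitalIntegral_indicator_quotientMeasure_eq_mul_ncard_shell γ K t ν hS hSK hK ht hfin, hν, ENNReal.toReal_one, one_mul,
    Nat.card_coe_set_eq]

end Quotient

end Summit.HodgeConjecture.HodgeConjecture.R90.S6

end
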